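import Summits.AtomisticToContinuum.FouriersLaw.Theorems.HonestZwanzigPositiveMemoryFeshbachDuality
import Summits.AtomisticToContinuum.FouriersLaw.Theorems.HonestZwanzigPositiveMemoryProfileForm
import Summits.AtomisticToContinuum.FouriersLaw.Theorems.HonestZwanzigPositiveMemoryProfileVariance

/-!
# HonestZwanzig / PositiveMemory — the tent reduction (line `Sketch`)

Support file for item `stmt-AtomisticToContinuum-12694` (`PositiveMemory` of route `HonestZwanzig`, sub-problem
`FouriersLaw`): the composition of line `Sketch` that is free of crux #4. The landed fixed-`N` stubs
`stub_feshbachDuality`, `stub_profileForm`, `stub_profileVariance` on the tent `ξ_x = min(x, N−1−x)` give, at fixed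
`N ≥ 3` and small `s > 0`, `schur_s(J,J) ≥ (T²Σξ²/2)²/(ξᵀG(s)ξ) − s·cov(E_ξ,E_ξ) − slack`; with the two `N`-uniform stubs
(tent escape `ξᵀG(s)ξ ≤ C_E N⁵`; apex sub-extensivity, slack `εN + C_A(ε)`) this is the floor `Σ_b ρ_b ≥ (κ − ε)N − C_A`
(`fixedN_floor`, `tent_sq_sum_ge`), whence `k ≥ κ` (Ohm bookkeeping; a private copy of `ohm_floor` of the companion
`…PositiveMemoryRobinReduction` keeps the two files independent) and bulk `ρ_b ≥ κ/2` (`stub_tentReduction`).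
-/

noncomputable section

open MeasureTheory Finset Real Set Filter Topology
open Literature.MathematicalPhysics.KineticTheory.HeatConduction
open Summit.AtomisticToContinuum.FouriersLaw.Theorems.HonestZwanzig.NetworkReduction

namespace Summit.AtomisticToContinuum.FouriersLaw.Theorems.HonestZwanzig.PositiveMemory

/-! ### Elementary real-variable lemmas -/

/-- **The fixed-`s` bound.** If `total = Σ_b σ_b`, `tent ≤ total + C_A`, `form = s·V + tent`,
`cq² ≤ gq·form` with `0 < gq ≤ M` and `0 ≤ q ≤ cq`, then `q²/M − s·V − C_A ≤ Σ_b σ_b`. -/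
theorem fixed_s_bound {ι : Type*} [Fintype ι] {σ : ι → ℝ} {total tent form gq cq q V CA M s : ℝ}
    (hadd : total = ∑ b, σ b) (hloc : tent ≤ total + CA) (hform : form = s * V + tent)
    (hdual : cq ^ 2 ≤ gq * form) (hgq : 0 < gq) (hgqM : gq ≤ M) (hq : 0 ≤ q) (hqc : q ≤ cq) :
    q ^ 2 / M - s * V - CA ≤ ∑ b, σ b := by
  have hM : 0 < M := lt_of_lt_of_le hgq hgqM
  have h2 : q ^ 2 ≤ gq * form := (pow_le_pow_left₀ hq hqc 2).trans hdual
  have hform0 : 0 ≤ form := by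
    by_contra h
    push Not at h
    have : gq * form < 0 := mul_neg_of_pos_of_neg hgq h
    nlinarith [sq_nonneg q]
  have h3 : q ^ 2 / M ≤ form := by
    rw [div_le_iff₀ hM]
    nlinarith
  rw [← hadd]
  linarith

/-- **The tent profile is extensive**: `Σ_x min(x, N−1−x)² ≥ N³/256` for `N ≥ 6`. -/
theorem tent_sq_sum_ge {N : ℕ} (hN : 6 ≤ N) (ξ : Fin N → ℝ)
    (hξ : ∀ x : Fin N, ξ x = ((min x.val (N - 1 - x.val) : ℕ) : ℝ)) :
    (N : ℝ) ^ 3 / 256 ≤ ∑ x, ξ x ^ 2 := by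
  set m : ℕ := N / 2 with hm
  have hm2 : N ≤ 2 * m + 1 := by omega
  have hm3 : 3 ≤ m := by omega
  set f : ℕ → ℝ := fun i => (((min i (N - 1 - i) : ℕ) : ℝ)) ^ 2 with hf
  have hsum : ∑ x : Fin N, ξ x ^ 2 = ∑ i ∈ Finset.range N, f i := by
    rw [← Fin.sum_univ_eq_sum_range]
    exact Finset.sum_congr rfl fun x _ => by rw [hξ]
  rw [hsum]
  have hsub : Finset.range m ⊆ Finset.range N := by
    intro x hx
    simp only [Finset.mem_range] at hx ⊢
    omega
  have hle1 : ∑ i ∈ Finset.range m, f i ≤ ∑ i ∈ Finset.range N, f i :=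
    Finset.sum_le_sum_of_subset_of_nonneg hsub fun i _ _ => by positivity
  have hleft : ∀ i ∈ Finset.range m, f i = (i : ℝ) ^ 2 := by
    intro i hi
    rw [Finset.mem_range] at hi
    have : min i (N - 1 - i) = i := min_eq_left (by omega)
    simp only [hf, this]
  rw [Finset.sum_congr rfl hleft] at hle1
  have hm1 : 1 ≤ m := by omega
  have hG : (∑ i ∈ Finset.range m, (i : ℝ)) * 2 = (m : ℝ) * ((m : ℝ) - 1) := by
    have h := congrArg (fun n : ℕ => (n : ℝ)) (Finset.sum_range_id_mul_two m)
    simpa [Nat.cast_sub hm1] using h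
  have hsq : (m : ℝ) * ((m : ℝ) - 1) ^ 2 / 4 ≤ ∑ i ∈ Finset.range m, (i : ℝ) ^ 2 := by
    have hpt : ∀ i ∈ Finset.range m,
        ((m : ℝ) - 1) * (i : ℝ) - ((m : ℝ) - 1) ^ 2 / 4 ≤ (i : ℝ) ^ 2 := by
      intro i _
      nlinarith [sq_nonneg ((i : ℝ) - ((m : ℝ) - 1) / 2)]
    have h := Finset.sum_le_sum hpt
    rw [Finset.sum_sub_distrib, ← Finset.mul_sum, Finset.sum_const, Finset.card_range,
      nsmul_eq_mul] at h
    have hS : ∑ i ∈ Finset.range m, (i : ℝ) = (m : ℝ) * ((m : ℝ) - 1) / 2 := by linarith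
    rw [hS] at h
    linarith
  have hmR : (N : ℝ) ≤ 2 * m + 1 := by exact_mod_cast hm2
  have hN6 : (6 : ℝ) ≤ N := by exact_mod_cast hN
  have ha : (N : ℝ) / 4 ≤ m := by linarith
  have hb : (N : ℝ) / 4 ≤ (m : ℝ) - 1 := by linarith
  have hN0 : (0 : ℝ) ≤ (N : ℝ) / 4 := by positivity
  have hcube : ((N : ℝ) / 4) ^ 2 * ((N : ℝ) / 4) ≤ ((m : ℝ) - 1) ^ 2 * m :=
    mul_le_mul (pow_le_pow_left₀ hN0 hb 2) ha hN0 (sq_nonneg _)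
  have : (N : ℝ) ^ 3 / 256 = ((N : ℝ) / 4) ^ 2 * ((N : ℝ) / 4) / 4 := by ring
  rw [this]
  linarith

/-- Ohm bookkeeping `N → ∞` (private copy of `ohm_floor` of `…PositiveMemoryRobinReduction`): `κ ≤ k`. -/
private theorem ohm_floor_tent {k C κ CA : ℝ} {N₁ : ℕ} (ρ : (N : ℕ) → Fin N → ℝ) (hC : 0 ≤ C)
    (hall : ∀ N : ℕ, N₁ ≤ N → ∀ b : Fin N, |ρ N b - k| ≤ C + |k|)
    (hbulk : ∀ ε : ℝ, 0 < ε → ∃ R : ℕ, ∀ N : ℕ, N₁ ≤ N → ∀ b : Fin N,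
      R ≤ b.val → b.val + 2 + R ≤ N → |ρ N b - k| ≤ ε)
    (hfloor : ∀ N : ℕ, N₁ ≤ N → κ * N - CA ≤ ∑ b, ρ N b) : κ ≤ k := by
  by_contra hlt
  push Not at hlt
  set ε : ℝ := (κ - k) / 2 with hε
  have hεpos : 0 < ε := by rw [hε]; linarith
  obtain ⟨R, hR⟩ := hbulk ε hεpos
  set K : ℝ := (2 * R + 1) * (C + |k|) with hK
  obtain ⟨N, hN⟩ := exists_nat_gt (max (N₁ : ℝ) ((CA + K) / ε))
  have hN₁ : N₁ ≤ N := by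
    have : (N₁ : ℝ) < N := (le_max_left _ _).trans_lt hN
    exact_mod_cast this.le
  have hNε : (CA + K) / ε < N := (le_max_right _ _).trans_lt hN
  have hsum : ∑ b, ρ N b ≤ N * k + (N * ε + (2 * R + 1) * (C + |k|)) := by
    have h1 : ∑ b, ρ N b ≤ ∑ b : Fin N, (k + |ρ N b - k|) :=
      Finset.sum_le_sum fun b _ => by linarith [le_abs_self (ρ N b - k)]
    have h2 : ∑ b : Fin N, (k + |ρ N b - k|) = N * k + ∑ b : Fin N, |ρ N b - k| := by
      rw [Finset.sum_add_distrib, Finset.sum_const, Finset.card_univ, Fintype.card_fin, nsmul_eq_mul]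
    have h3 := sum_abs_le_of_bulk R (fun b : Fin N => ρ N b - k) hεpos.le (by positivity)
      (fun b h1 h2 => hR N hN₁ b h1 h2) (fun b => hall N hN₁ b)
    linarith
  have hfl := hfloor N hN₁
  have h4 : (N : ℝ) * ε ≤ CA + K := by
    have : κ - k - ε = ε := by rw [hε]; ring
    nlinarith
  rw [div_lt_iff₀ hεpos] at hNε
  linarith

/-! ### The fixed-`N` floor for the canonical objects -/

section Package

variable {ω₂ lam β γ : ℝ} {N : ℕ} {T : ℝ}
  {Adm : (PhaseSpace N → ℝ) → Prop}
  {corr : (PhaseSpace N → ℝ) → (PhaseSpace N → ℝ) → ℝ → ℝ}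
  {lap : ℝ → (PhaseSpace N → ℝ) → (PhaseSpace N → ℝ) → ℝ}
  {cov : (PhaseSpace N → ℝ) → (PhaseSpace N → ℝ) → ℝ}
  {e : Fin N → PhaseSpace N → ℝ}
  {G : ℝ → Matrix (Fin N) (Fin N) ℝ}
  {schur : ℝ → (PhaseSpace N → ℝ) → (PhaseSpace N → ℝ) → ℝ}
  {F : ℝ → Fin N → Fin N → ℝ}
  (hAdm : ∀ f, Adm f ↔ (Continuous f ∧ ∃ A : ℝ, ∀ z,
    |f z| ≤ A * Real.exp ((pinnedChain ω₂ lam β γ).hamiltonian N z / (8 * T))))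
  (hcorr : ∀ f g t, corr f g t =
    (∫ z, f z * (∫ y, g y ∂((pinnedChain ω₂ lam β γ).transitionKernel N T T t.toNNReal z))
      ∂(pinnedChain ω₂ lam β γ).gibbsMeasure N T) -
    (∫ z, f z ∂(pinnedChain ω₂ lam β γ).gibbsMeasure N T) *
      (∫ z, g z ∂(pinnedChain ω₂ lam β γ).gibbsMeasure N T))
  (hlap : ∀ s f g, lap s f g = ∫ t in Set.Ioi (0 : ℝ), Real.exp (-(s * t)) * corr f g t)
  (hcov : ∀ f g, cov f g = (∫ z, f z * g z ∂(pinnedChain ω₂ lam β γ).gibbsMeasure N T) -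
    (∫ z, f z ∂(pinnedChain ω₂ lam β γ).gibbsMeasure N T) *
      (∫ z, g z ∂(pinnedChain ω₂ lam β γ).gibbsMeasure N T))
  (he : ∀ x z, e x z = z.2 x ^ 2 / 2 + (pinnedChain ω₂ lam β γ).U (z.1 x) +
    ∑ j : Fin N, ((if j.val = x.val + 1 then (pinnedChain ω₂ lam β γ).V (z.1 j - z.1 x) / 2 else 0) +
      (if x.val = j.val + 1 then (pinnedChain ω₂ lam β γ).V (z.1 x - z.1 j) / 2 else 0)))
  (hG : ∀ s x y, G s x y = lap s (e x) (e y))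
  (hschur : ∀ s f g, schur s f g = lap s f g - ∑ x, ∑ y, lap s f (e x) * (G s)⁻¹ x y * lap s (e y) g)
  (hF : ∀ s x y, F s x y = s * cov (e x) (e y) - cov (e x) ((pinnedChain ω₂ lam β γ).generator N T T (e y)) -
      schur s (fun z => (pinnedChain ω₂ lam β γ).generator N T T (e x) (z.1, -z.2))
        ((pinnedChain ω₂ lam β γ).generator N T T (e y)))
  (hFI : ∀ f g : PhaseSpace N → ℝ, Adm f → Adm g →
    Integrable f ((pinnedChain ω₂ lam β γ).gibbsMeasure N T) ∧
    (∀ t : ℝ, 0 ≤ t → Integrable (fun z => f z *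
      (∫ y, g y ∂((pinnedChain ω₂ lam β γ).transitionKernel N T T t.toNNReal z)))
      ((pinnedChain ω₂ lam β γ).gibbsMeasure N T)) ∧
    IntegrableOn (corr f g) (Set.Ioi 0) ∧
    (∀ t : ℝ, 0 ≤ t → corr f g t = corr (fun z => g (z.1, -z.2)) (fun z => f (z.1, -z.2)) t) ∧
    (∀ s : ℝ, 0 < s → ∀ x : Fin N,
      s * lap s (e x) g - cov (e x) g =
        lap s (fun z => (pinnedChain ω₂ lam β γ).generator N T T (e x) (z.1, -z.2)) g ∧
      s * lap s f (e x) - cov f (e x) = lap s f ((pinnedChain ω₂ lam β γ).generator N T T (e x))))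
  (hGSE : ∀ (x : Fin N) (z : PhaseSpace N), (pinnedChain ω₂ lam β γ).generator N T T (e x) z =
    (∑ b : Fin N, ((if x.val = b.val + 1 then (pinnedChain ω₂ lam β γ).bondCurrent N b z else 0) -
      (if b = x then (pinnedChain ω₂ lam β γ).bondCurrent N b z else 0))) +
    (if x.val = 0 then (pinnedChain ω₂ lam β γ).γ * (T - z.2 x ^ 2) else 0) +
    (if x.val = N - 1 then (pinnedChain ω₂ lam β γ).γ * (T - z.2 x ^ 2) else 0))
  (hPS : ∀ x y : Fin N, cov (e x) ((pinnedChain ω₂ lam β γ).generator N T T (e y)) =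
    -(if x = y ∧ (x.val = 0 ∨ x.val = N - 1) then (pinnedChain ω₂ lam β γ).γ * T ^ 2 else 0))
  (hω : 0 < ω₂) (hl : 0 ≤ lam) (hβ : 0 ≤ β) (hT : 0 < T)

include hAdm hcorr hlap hcov he hG hschur hF hFI hGSE hPS hω hl hβ hT in
/-- **The fixed-`N` floor.** At `N ≥ 3`, with `G(s)` positive definite, the tent profile `ξ` and its
current `J_ξ`: if `ξᵀG(s)ξ ≤ C_E N⁵` and `schur_s(J_ξ,J_ξ) ≤ schur_s(J,J) + C_A` for `0 < s < s₀`, then the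
orthogonal-dynamics DC responses `ρ_b = lim_{s↓0} schur_s(j_b, J)` satisfy
`(T²Σξ²/2)²/(max(C_E,1)·N⁵) − C_A ≤ Σ_b ρ_b`. -/
theorem fixedN_floor (hN : 3 ≤ N)
    (hGp : ∀ s : ℝ, 0 < s → ∀ v : Fin N → ℝ, v ≠ 0 → 0 < ∑ x, ∑ y, v x * G s x y * v y)
    (ξ : Fin N → ℝ) (hξ : ∀ x : Fin N, ξ x = ((min x.val (N - 1 - x.val) : ℕ) : ℝ))
    {Jξ : PhaseSpace N → ℝ}
    (hJξ : Jξ = fun z => ∑ b : Fin N, (∑ j : Fin N, if j.val = b.val + 1 then ξ j - ξ b else 0) *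
      (pinnedChain ω₂ lam β γ).bondCurrent N b z)
    {CE CA s₀ : ℝ} (hs₀ : 0 < s₀)
    (hesc : ∀ s : ℝ, 0 < s → s < s₀ → ∑ x, ∑ y, ξ x * G s x y * ξ y ≤ CE * (N : ℝ) ^ 5)
    (hloc : ∀ s : ℝ, 0 < s → s < s₀ → schur s Jξ Jξ ≤
      schur s (fun z => ∑ i : Fin N, (pinnedChain ω₂ lam β γ).bondCurrent N i z)
        (fun z => ∑ i : Fin N, (pinnedChain ω₂ lam β γ).bondCurrent N i z) + CA)
    (ρ : Fin N → ℝ)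
    (hρ : ∀ b : Fin N, b.val + 1 < N → Tendsto (fun s => schur s ((pinnedChain ω₂ lam β γ).bondCurrent N b)
      (fun z => ∑ i : Fin N, (pinnedChain ω₂ lam β γ).bondCurrent N i z)) (nhdsWithin (0 : ℝ) (Set.Ioi 0))
      (nhds (ρ b)))
    (hρ0 : ∀ b : Fin N, ¬ b.val + 1 < N → ρ b = 0) :
    (T ^ 2 / 2 * ∑ x, ξ x ^ 2) ^ 2 / (max CE 1 * (N : ℝ) ^ 5) - CA ≤ ∑ b, ρ b := by
  set J : PhaseSpace N → ℝ := fun z => ∑ i : Fin N, (pinnedChain ω₂ lam β γ).bondCurrent N i z with hJ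
  set j : Fin N → PhaseSpace N → ℝ := (pinnedChain ω₂ lam β γ).bondCurrent N with hj
  have hJa : Adm J := adm_totalCurrent Adm hAdm hω hl hβ hT
  have hex : ∀ x, Adm (e x) := fun x => adm_e Adm hAdm e he hω hl hβ hT x
  have hρ' : ∀ b : Fin N, Tendsto (fun s => schur s (j b) J) (nhdsWithin (0 : ℝ) (Set.Ioi 0))
      (nhds (ρ b)) := by
    intro b
    by_cases hb : b.val + 1 < N
    · exact hρ b hb
    · have h0 : ∀ s, schur s (j b) J = 0 := by
        intro s
        rw [hschur, pkg_j_last hcorr hlap s b hb, zero_sub, neg_eq_zero]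
        refine Finset.sum_eq_zero fun x _ => Finset.sum_eq_zero fun y _ => ?_
        rw [pkg_j_last hcorr hlap s b hb, zero_mul, zero_mul]
      rw [show (fun s => schur s (j b) J) = fun _ => 0 from funext h0, hρ0 b hb]
      exact tendsto_const_nhds
  have hUB : Tendsto (fun s => ∑ b, schur s (j b) J) (nhdsWithin (0 : ℝ) (Set.Ioi 0))
      (nhds (∑ b, ρ b)) := tendsto_finsetSum _ fun b _ => hρ' b
  set V : ℝ := cov (fun z => ∑ x, ξ x * e x z) (fun z => ∑ x, ξ x * e x z) with hV
  set Q : ℝ := T ^ 2 / 2 * ∑ x, ξ x ^ 2 with hQ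
  set M : ℝ := max CE 1 * (N : ℝ) ^ 5 with hM
  have hLB : Tendsto (fun s : ℝ => Q ^ 2 / M - s * V - CA) (nhdsWithin (0 : ℝ) (Set.Ioi 0))
      (nhds (Q ^ 2 / M - CA)) := by
    have hc : Continuous fun s : ℝ => Q ^ 2 / M - s * V - CA := by fun_prop
    have h := hc.tendsto 0
    simp only [zero_mul, sub_zero] at h
    exact h.mono_left nhdsWithin_le_nhds
  have hξ0 : ξ ≠ 0 := by
    intro h
    have h1 : ξ ⟨1, by omega⟩ = 0 := by rw [h]; rfl
    rw [hξ] at h1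
    simp only [Nat.cast_eq_zero, Nat.min_eq_zero_iff] at h1
    omega
  have hξb : ∀ x : Fin N, (x.val = 0 ∨ x.val = N - 1) → ξ x = 0 := by
    intro x hx
    rw [hξ]
    rcases hx with h | h <;> simp [h]
  have hsand : ∀ᶠ s in nhdsWithin (0 : ℝ) (Set.Ioi 0), Q ^ 2 / M - s * V - CA ≤ ∑ b, schur s (j b) J := by
    filter_upwards [Ioo_mem_nhdsGT hs₀] with s hs
    have hs1 : 0 < s := hs.1
    have hadd : schur s J J = ∑ b, schur s (j b) J := by
      have h := schur_lincomb (lap s) (schur s) e J (G s) (hschur s) (fun _ => 1) 0 J J j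
        (by rw [pkg_J_lap hAdm hcorr hlap hFI hω hl hβ hT hs1.le hJa]; simp [hj])
        (fun u => by rw [pkg_J_lap hAdm hcorr hlap hFI hω hl hβ hT hs1.le (hex u)]; simp [hj])
      rw [h]
      simp
    have hform := fixedN_profileForm hAdm hcorr hlap hcov he hFI hGSE hPS hω hl hβ hT ξ hξb hJξ hs1.le
      (G s) (schur s) (hschur s) (F s) (hF s)
    have hdual := fixedN_duality hAdm hlap hcov he hFI hGSE hPS hω hl hβ hT hs1 (G s) (hG s) (schur s)
      (hschur s) (F s) (hF s) (hGp s hs1) ξ ξ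
    have hvar := profileVariance_package cov hcov e he hω hl hβ hT ξ
    have hgq : 0 < ∑ x, ∑ y, ξ x * G s x y * ξ y := hGp s hs1 ξ hξ0
    have hgqM : ∑ x, ∑ y, ξ x * G s x y * ξ y ≤ M := (hesc s hs1 hs.2).trans (by
      have h5 : (0 : ℝ) ≤ (N : ℝ) ^ 5 := by positivity
      exact mul_le_mul_of_nonneg_right (le_max_left _ _) h5)
    have hQ0 : 0 ≤ Q := by positivity
    exact fixed_s_bound hadd (hloc s hs1 hs.2) hform hdual hgq hgqM hQ0 hvar
  exact le_of_tendsto_of_tendsto hLB hUB hsand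

end Package

/-! ### The registered stub: the tent reduction -/

/-- **Stub — the tent reduction** (composition step of line `Sketch`, free of crux #4): the fixed-`N` package
`FeshbachIdentities`, the orthogonal Ohm law `OrthogonalOhm`, tent escape (`ξᵀG(s)ξ ≤ C_E N⁵` for small `s`) and
apex sub-extensivity (`schur_s(J_ξ,J_ξ) ≤ schur_s(J,J) + εN + C_A(ε)` for small `s`, every `ε > 0`) imply
`PositiveMemory`: `Σ_b ρ_b ≥ (κ − ε)N − C_A` at every `N ≥ 6` (`fixedN_floor`, `tent_sq_sum_ge`), hence `k ≥ κ`
(`ohm_floor`), and every bulk limit equals the `OrthogonalOhm` response (uniqueness of limits in `𝓝[>] 0`), so it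
is `≥ k − κ/2 ≥ κ/2`. -/
theorem stub_tentReduction :
    Summit.AtomisticToContinuum.FouriersLaw.Theses.HonestZwanzig.FeshbachIdentities →
    Summit.AtomisticToContinuum.FouriersLaw.Theses.HonestZwanzig.OrthogonalOhm →
    (
      ∀ ω₂ lam β γ : ℝ, 0 < ω₂ → 0 < lam → 0 < β → 0 < γ → ∀ T : ℝ, 0 < T → ∃ C_E : ℝ, ∀ N : ℕ, 2 ≤ N →
      let P := Literature.MathematicalPhysics.KineticTheory.HeatConduction.pinnedChain ω₂ lam β γ;
      let X := Literature.MathematicalPhysics.KineticTheory.HeatConduction.PhaseSpace N;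
      let μ : MeasureTheory.Measure X := P.gibbsMeasure N T;
      let corr : (X → ℝ) → (X → ℝ) → ℝ → ℝ := fun f g t =>
        (∫ z, f z * (∫ y, g y ∂(P.transitionKernel N T T t.toNNReal z)) ∂μ) - (∫ z, f z ∂μ) * (∫ z, g z ∂μ);
      let lap : ℝ → (X → ℝ) → (X → ℝ) → ℝ := fun s f g =>
        ∫ t in Set.Ioi (0 : ℝ), Real.exp (-(s * t)) * corr f g t;
      let e : Fin N → X → ℝ := fun x z => z.2 x ^ 2 / 2 + P.U (z.1 x) +
        ∑ j : Fin N, ((if j.val = x.val + 1 then P.V (z.1 j - z.1 x) / 2 else 0) +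
          (if x.val = j.val + 1 then P.V (z.1 x - z.1 j) / 2 else 0));
      let G : ℝ → Matrix (Fin N) (Fin N) ℝ := fun s => Matrix.of fun x y => lap s (e x) (e y);
      let ξ : Fin N → ℝ := fun x => ((min x.val (N - 1 - x.val) : ℕ) : ℝ);
      ∃ s₀ : ℝ, 0 < s₀ ∧ ∀ s : ℝ, 0 < s → s < s₀ →
        (∑ x : Fin N, ∑ y : Fin N, ξ x * G s x y * ξ y) ≤ C_E * (N : ℝ) ^ 5) →
    (
      ∀ ω₂ lam β γ : ℝ, 0 < ω₂ → 0 < lam → 0 < β → 0 < γ → ∀ T : ℝ, 0 < T → ∀ ε : ℝ, 0 < ε → ∃ C_A : ℝ, ∀ N : ℕ, 2 ≤ N →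
      let P := Literature.MathematicalPhysics.KineticTheory.HeatConduction.pinnedChain ω₂ lam β γ;
      let X := Literature.MathematicalPhysics.KineticTheory.HeatConduction.PhaseSpace N;
      let μ : MeasureTheory.Measure X := P.gibbsMeasure N T;
      let corr : (X → ℝ) → (X → ℝ) → ℝ → ℝ := fun f g t =>
        (∫ z, f z * (∫ y, g y ∂(P.transitionKernel N T T t.toNNReal z)) ∂μ) - (∫ z, f z ∂μ) * (∫ z, g z ∂μ);
      let lap : ℝ → (X → ℝ) → (X → ℝ) → ℝ := fun s f g =>
        ∫ t in Set.Ioi (0 : ℝ), Real.exp (-(s * t)) * corr f g t;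
      let e : Fin N → X → ℝ := fun x z => z.2 x ^ 2 / 2 + P.U (z.1 x) +
        ∑ j : Fin N, ((if j.val = x.val + 1 then P.V (z.1 j - z.1 x) / 2 else 0) +
          (if x.val = j.val + 1 then P.V (z.1 x - z.1 j) / 2 else 0));
      let G : ℝ → Matrix (Fin N) (Fin N) ℝ := fun s => Matrix.of fun x y => lap s (e x) (e y);
      let schur : ℝ → (X → ℝ) → (X → ℝ) → ℝ := fun s f g =>
        lap s f g - ∑ x : Fin N, ∑ y : Fin N, lap s f (e x) * (G s)⁻¹ x y * lap s (e y) g;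
      let J : X → ℝ := fun z => ∑ i : Fin N, P.bondCurrent N i z;
      let ξ : Fin N → ℝ := fun x => ((min x.val (N - 1 - x.val) : ℕ) : ℝ);
      let Jξ : X → ℝ := fun z =>
        ∑ b : Fin N, (∑ j : Fin N, if j.val = b.val + 1 then ξ j - ξ b else 0) * P.bondCurrent N b z;
      ∃ s₀ : ℝ, 0 < s₀ ∧ ∀ s : ℝ, 0 < s → s < s₀ → schur s Jξ Jξ ≤ schur s J J + (ε * (N : ℝ) + C_A)) →
    Summit.AtomisticToContinuum.FouriersLaw.Theses.HonestZwanzig.PositiveMemory := by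
  intro hFI hOO hE hA ω₂ lam β γ hω hl hβ hγ T hT
  obtain ⟨k, C, hkC⟩ := hOO ω₂ lam β γ hω hl hβ hγ T hT
  obtain ⟨CE, hCE⟩ := hE ω₂ lam β γ hω hl hβ hγ T hT
  obtain ⟨R₁, hR₁⟩ := hkC 1 one_pos
  have hb1 := fun (N : ℕ) (hN : 2 ≤ N) => (hR₁ N hN).1
  choose ρf hρf using hb1
  have hC0 : 0 ≤ C := (abs_nonneg _).trans (hρf 2 le_rfl ⟨0, by norm_num⟩ (by norm_num)).2.1
  set ρ : (N : ℕ) → Fin N → ℝ := fun N b => if h : 2 ≤ N ∧ b.val + 1 < N then ρf N h.1 b h.2 else 0 with hρ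
  have hρt : ∀ (N : ℕ) (hN : 2 ≤ N) (b : Fin N) (hb : b.val + 1 < N), ρ N b = ρf N hN b hb :=
    fun N hN b hb => by simp only [hρ, dif_pos (And.intro hN hb)]
  have hρ0 : ∀ (N : ℕ) (b : Fin N), ¬ b.val + 1 < N → ρ N b = 0 :=
    fun N b hb => by simp only [hρ]; exact dif_neg fun h => hb h.2
  set κ : ℝ := (T ^ 2 / 2 / 256) ^ 2 / max CE 1 with hκ
  have hκ0 : 0 < κ := by positivity
  have hfloor : ∀ ε : ℝ, 0 < ε → ∃ CA : ℝ, ∀ N : ℕ, 6 ≤ N → (κ - ε) * N - CA ≤ ∑ b, ρ N b := by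
    intro ε hε
    obtain ⟨CA, hCA⟩ := hA ω₂ lam β γ hω hl hβ hγ T hT ε hε
    refine ⟨CA, fun N hN6 => ?_⟩
    have hN : 2 ≤ N := by omega
    obtain ⟨-, hFI2, -, hGp⟩ := hFI ω₂ lam β γ hω hl hβ hγ T hT N hN
    obtain ⟨s₁, hs₁, hesc⟩ := hCE N hN
    obtain ⟨s₂, hs₂, hloc⟩ := hCA N hN
    have key := fixedN_floor (ω₂ := ω₂) (lam := lam) (β := β) (γ := γ) (N := N) (T := T)
      (fun f => Iff.rfl) (fun f g t => rfl) (fun s f g => rfl) (fun f g => rfl) (fun x z => rfl)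
      (fun s x y => rfl) (fun s f g => rfl) (fun s x y => rfl) hFI2
      (fun x z => generatorSiteEnergy_proof ω₂ lam β γ N hN T T x z)
      (fun x y => ((parityStatics_proof ω₂ lam β γ hω hl hβ hγ T hT N hN) x).2 y)
      hω hl.le hβ.le hT (by omega) hGp (fun x => ((min x.val (N - 1 - x.val) : ℕ) : ℝ)) (fun x => rfl) rfl
      (lt_min hs₁ hs₂) (fun s hs hs' => hesc s hs (hs'.trans_le (min_le_left _ _)))
      (fun s hs hs' => hloc s hs (hs'.trans_le (min_le_right _ _))) (ρ N)
      (fun b hb => by rw [hρt N hN b hb]; exact (hρf N hN b hb).1) (fun b hb => hρ0 N b hb)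
    have hS := tent_sq_sum_ge hN6 (fun x : Fin N => ((min x.val (N - 1 - x.val) : ℕ) : ℝ)) (fun x => rfl)
    have hQ : T ^ 2 / 2 * ((N : ℝ) ^ 3 / 256) ≤
        T ^ 2 / 2 * ∑ x : Fin N, ((min x.val (N - 1 - x.val) : ℕ) : ℝ) ^ 2 :=
      mul_le_mul_of_nonneg_left hS (by positivity)
    have hQ2 : (T ^ 2 / 2 * ((N : ℝ) ^ 3 / 256)) ^ 2 ≤
        (T ^ 2 / 2 * ∑ x : Fin N, ((min x.val (N - 1 - x.val) : ℕ) : ℝ) ^ 2) ^ 2 :=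
      pow_le_pow_left₀ (by positivity) hQ 2
    have hM0 : 0 < max CE 1 * (N : ℝ) ^ 5 := by positivity
    have hκN : κ * N = (T ^ 2 / 2 * ((N : ℝ) ^ 3 / 256)) ^ 2 / (max CE 1 * (N : ℝ) ^ 5) := by
      rw [hκ]
      field_simp
    have hκN' : (κ - ε) * N - CA = κ * N - (ε * N + CA) := by ring
    rw [hκN', hκN]
    have := div_le_div_of_nonneg_right hQ2 hM0.le
    linarith
  have hall : ∀ N : ℕ, 6 ≤ N → ∀ b : Fin N, |ρ N b - k| ≤ C + |k| := by
    intro N hN b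
    by_cases hb : b.val + 1 < N
    · have hN2 : 2 ≤ N := by omega
      rw [hρt N hN2 b hb]
      have h := (hρf N hN2 b hb).2.1
      calc |ρf N hN2 b hb - k| ≤ |ρf N hN2 b hb| + |k| := abs_sub _ _
        _ ≤ C + |k| := by linarith
    · rw [hρ0 N b hb, zero_sub, abs_neg]
      linarith [abs_nonneg k]
  have hbulk : ∀ ε : ℝ, 0 < ε → ∃ R : ℕ, ∀ N : ℕ, 6 ≤ N → ∀ b : Fin N,
      R ≤ b.val → b.val + 2 + R ≤ N → |ρ N b - k| ≤ ε := by
    intro ε hε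
    obtain ⟨R, hR⟩ := hkC ε hε
    refine ⟨R, fun N hN b h1 h2 => ?_⟩
    have hN2 : 2 ≤ N := by omega
    have hb : b.val + 1 < N := by omega
    obtain ⟨hbonds, -⟩ := hR N hN2
    obtain ⟨ρ', hρ', -, hρ'k⟩ := hbonds b hb
    have heq : ρf N hN2 b hb = ρ' := tendsto_nhds_unique (hρf N hN2 b hb).1 hρ'
    rw [hρt N hN2 b hb, heq]
    exact hρ'k h1 h2
  have hk : κ ≤ k := by
    refine le_of_forall_pos_le_add fun ε hε => ?_
    obtain ⟨CA, hCA⟩ := hfloor ε hε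
    have h := ohm_floor_tent (N₁ := 6) ρ hC0 hall hbulk hCA
    linarith
  refine ⟨κ / 2, by positivity, ?_⟩
  obtain ⟨R, hR⟩ := hkC (κ / 2) (by positivity)
  refine ⟨R, fun N hN => ?_⟩
  intro P X μ corr lap e G schur J b hRb hbN ρ₀ hρ₀
  have hb : b.val + 1 < N := by omega
  obtain ⟨hbonds, -⟩ := hR N hN
  obtain ⟨ρ', hρ', -, hρ'k⟩ := hbonds b hb
  have heq : ρ₀ = ρ' := tendsto_nhds_unique hρ₀ hρ'
  have h1 := hρ'k hRb hbN
  rw [abs_le] at h1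
  rw [heq]
  linarith

end Summit.AtomisticToContinuum.FouriersLaw.Theorems.HonestZwanzig.PositiveMemory

end
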